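import Literature.Probability.LatticeModels.FKIsingInterfaceSource
import Literature.Probability.LatticeModels.FKIsingInterfaceTightnessProofs
import Literature.Probability.RandomPlanarGeometry.ObservableLocalMartingale
import HarnessLib

/-!
# FK-Ising interfaces and SLE_{16/3}: the identification step WITHOUT moment bounds

Topic `Literature/Probability/LatticeModels` (family `crit-ising`); theorems only, no definition
and no named fact. FK-Ising (`κ = 16/3`) counterpart of `InterfaceSLELocal.lean` /
`InterfaceSLELimitData.lean` (spin side, `κ = 3`).

Chelkak–Duminil-Copin–Hongler–Kemppainen–Smirnov, C. R. Math. 352 (2014), §3, and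
Duminil-Copin–Smirnov, Clay Math. Proc. 15 (2012), proof of Prop. 6.7 (p. 29), identify a
subsequential limit of the critical FK-Ising interfaces by expanding the martingale observable
`√π M_t^z = √(g_t'(z)/(g_t(z) - W_t))` at `z = iy → ∞`: "both coefficients `W_t` and
`W_t² - (16/3)t` are martingales … Lévy's theorem implies that `W_t = √(16/3) B_t`". The
exchange of expansion and conditional expectation in the printed argument uses moment bounds on
the driving process (CDHKS Thm. 3: "`sup_δ E[exp(ε|W^δ_t|/√t)] < ∞`"; Kemppainen–Smirnov 2017,
Prop. 3.8), and the tree's first transcription carried them: the layer-5 named fact (M5′)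
`exists_cylinderObservableIdentity_fkInterface` (`FKIsingNaturalMartingale.lean`) has an `L³`
running-supremum clause, and the assembly `isSLELaw_sixteen_thirds_of_limitData`
(`FKIsingCylinderIdentityAssembly.lean`) a sub-exponential tail hypothesis `htail` on the discrete
driving processes. Meanwhile the tree PROVED the extraction of the two driving martingales in
Lévy's LOCAL format with no moment hypothesis at all
(`Loewner.isLocalMartingale_hasQuadraticVariation_of_fkObservable`,
`RandomPlanarGeometry/ObservableLocalMartingale.lean`: localisation at the far-field stopping
times of fixed levels, observable levels `y → ∞`). This file threads that theorem through the
FK identification, so that the tail/moment input leaves the frontier of crit-ising.S17 (FK):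

* `isSLELaw_sixteen_thirds_of_cylinderIdentity'` — **CDHKS §3 as one theorem, locally and
  moment-free**: a probability measure `μ` on curve classes carrying a process `W` with strongly
  measurable marginals, continuous paths, `W 0 = 0`, `μ`-a.e. driving the curve through a
  chordal uniformizing map `φ` of `(D; a, b)`, whose time-limited FK observables
  `N^y = observableProcess W y` satisfy the cylinder identity
  `E_μ[(N^y_t - N^y_s) ψ(W_S)] = 0`, IS the chordal SLE_{16/3} law of `(D; a, b)` (monotone class
  ⟹ natural-filtration martingales ⟹ `(√(16/3))⁻¹ W` a continuous local martingale with
  quadratic variation `t` ⟹ Brownian coupling by Lévy ⟹ Rohde–Schramm at `κ = 16/3`; every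
  arrow a theorem of the tree);
* `exists_drivingData_of_limitData` — from **(J₀)** (`μ`-a.e. describability through `φ`, curves
  from `a`, convergence in distribution in `C([0, ∞), ℝ)` of the discrete capacity driving
  processes `V^k` to `drivingFunction φ`: Kemppainen–Smirnov 2017, Thm. 1.5 / Cor. 1.7 with
  CDHKS Thm. 4 — and NO tail statement) and **(D)** (the discrete observable martingale data of
  `Loewner.integral_observableProcess_cylinder_eq_zero_of_discreteMartingales`: DCS Lemma 6.6 and
  Thm. 3.15 = Smirnov 2010, Thm. 2.2 over the slit domains) the process `W` and its four
  moment-free clauses plus the cylinder identity; hence `isSLELaw_sixteen_thirds_of_limitData'`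
  — **(J₀) ∧ (D) ⟹ `IsSLELaw (16/3) D μ`**;
* `isSLELaw_of_isSubseqLimitLaw_fkInterfaceCurve_of_limitData'` — the global form: if every
  subsequential limit law of the critical FK-Ising interface laws of a discretised Dobrushin
  domain admits SOME chordal uniformizing map with (J₀) ∧ (D) (the clause "curves from `a`"
  being automatic, `ae_source_eq_of_isSubseqLimitLaw_fkInterfaceCurve`), then the layer-1
  identification fact (L) `isSLELaw_of_isSubseqLimitLaw_fkInterfaceCurve` holds;
* `convergesInLawToSLE_sixteen_thirds_fkInterface_of_fkIsing_rsw_of_limitData'` — hence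
  **crit-ising.S17 (FK) `convergesInLawToSLE_sixteen_thirds_fkInterface` from the RSW crossing
  bound `fkIsing_rsw` (Duminil-Copin–Hongler–Nolin 2011, Thm. 1; it gives the traversal bound
  (C1), `fkInterface_traversalBound_of_fkIsing_rsw`) and (J₀) ∧ (D)** — the sharpest
  named-fact-free frontier of CDHKS Theorem 2 in the tree: Kemppainen–Smirnov's Thm. 1.5 /
  Cor. 1.7 without its Prop. 3.8, and Smirnov's observable convergence over the slit domains.

## References

* D. Chelkak, H. Duminil-Copin, C. Hongler, A. Kemppainen, S. Smirnov, *Convergence of Ising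
  interfaces to Schramm's SLE curves*, C. R. Math. Acad. Sci. Paris 352 (2014) 157–161
  (arXiv:1312.0533): Thm. 2, Thm. 3, Thm. 4, §3.
* H. Duminil-Copin, S. Smirnov, *Conformal invariance of lattice models*, Clay Math. Proc. 15
  (2012) 213–276 (arXiv:1109.1549): Thm. 6.4, Lemma 6.6, Thm. 3.15, Prop. 6.7 and its proof
  (p. 29).
* A. Kemppainen, S. Smirnov, *Random curves, scaling limits and Loewner evolutions*, Ann.
  Probab. 45 (2017) 698–779 (arXiv:1212.6215): Thm. 1.5, Cor. 1.7.
* S. Smirnov, *Conformal invariance in random cluster models. I*, Ann. Math. 172 (2010),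
  Thm. 2.2.
* H. Duminil-Copin, C. Hongler, P. Nolin, *Connection probabilities and RSW-type bounds for the
  two-dimensional FK Ising model*, Comm. Pure Appl. Math. 64 (2011), Thm. 1.
-/

noncomputable section

open MeasureTheory ProbabilityTheory Filter Topology Set
open UpperHalfPlane (upperHalfPlaneSet)
open scoped NNReal ENNReal
open Literature.Probability.RandomPlanarGeometry Literature.Probability.LatticeModels
  Literature.Probability.Percolation Literature.Probability.Process

namespace Literature.Probability.LatticeModels

open RandomPlanarGeometry.Loewner
open scoped Literature.Probability.RandomPlanarGeometry.PathBorel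

/-! ### CDHKS §3 as one theorem, moment-free: the cylinder identity identifies SLE_{16/3} -/

/-- **The observable martingale identity identifies chordal SLE_{16/3}, with no moment
hypothesis.** Let `φ` be a chordal uniformizing map of the Dobrushin domain `(D; a, b)`, `μ` a
probability measure on curve classes and `W : CurveClass ℂ → ([0, ∞) → ℝ)` a process with
strongly measurable marginals, continuous paths and `W 0 = 0`, `μ`-a.e. driving the curve through
`φ`, such that for every `y > 0` the time-limited FK observable process `N^y = observableProcess W y`
satisfies `E_μ[(N^y_t - N^y_s) ψ(W_S)] = 0` for all `s ≤ t`, all finite families of times `S ≤ s`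
and all continuous `|ψ| ≤ 1`. Then `μ` is the chordal SLE_{16/3} law of `(D; a, b)`. Chain (all
proved in the tree): cylinder identity ⟹ `Re/Im N^y` martingales in the natural filtration of
`W` (`martingale_re_im_observableProcess_of_cylinder`, monotone class) ⟹ `(√(16/3))⁻¹ W` is a
continuous local martingale with quadratic variation `t`
(`Loewner.isLocalMartingale_hasQuadraticVariation_of_fkObservable`: localisation at the far-field
stopping times `ρ_L`, expansion of CDHKS eq. (5) / DCS p. 29 at levels `y → ∞`) ⟹ Brownian
coupling (`exists_isSLEDrivingCoupling_of_isLocalMartingale_driving`, Lévy's characterisation) ⟹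
SLE_{16/3} law (`isSLELaw_sixteen_thirds_of_isSLEDrivingCoupling`, Rohde–Schramm at `κ = 16/3`).
The moment-free form of `isSLELaw_sixteen_thirds_of_cylinderIdentity`.
[cite: CDHKSCRAS2014, §3] [cite: DuminilCopinSmirnov2012Clay, Prop. 6.7 (proof, p. 29)] -/
theorem isSLELaw_sixteen_thirds_of_cylinderIdentity' {D : DobrushinDomain}
    {φ : ConformalEquiv upperHalfPlaneSet D.carrier} (hφ : D.IsChordalUniformizing φ)
    {μ : Measure (CurveClass ℂ)} [IsProbabilityMeasure μ] {W : CurveClass ℂ → ℝ≥0 → ℝ}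
    (hW : ∀ t, StronglyMeasurable (fun c ↦ W c t)) (hWc : ∀ c, Continuous (W c))
    (hW0 : ∀ c, W c 0 = 0)
    (hdrv : ∀ᵐ c ∂μ, Loewner.IsDrivenBy φ.boundaryExtension (D.pt 1) (W c) c)
    (hcyl : ∀ y : ℝ, 0 < y → ∀ s t : ℝ≥0, s ≤ t → ∀ (n : ℕ) (S : Fin n → ℝ≥0), (∀ k, S k ≤ s) →
      ∀ ψ : (Fin n → ℝ) → ℝ, Continuous ψ → (∀ v, |ψ v| ≤ 1) →
        ∫ c, (observableProcess (fun t c ↦ W c t) y t c -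
            observableProcess (fun t c ↦ W c t) y s c) * (ψ (fun k ↦ W c (S k)) : ℂ) ∂μ = 0) :
    IsSLELaw (16 / 3) D μ := by
  -- natural-filtration martingales (monotone class)
  have hmart : ∀ y : ℝ, 0 < y →
      Martingale (fun t c ↦ (observableProcess (fun t c ↦ W c t) y t c).re)
        (Filtration.natural (fun t c ↦ W c t) hW) μ ∧
      Martingale (fun t c ↦ (observableProcess (fun t c ↦ W c t) y t c).im)
        (Filtration.natural (fun t c ↦ W c t) hW) μ := fun y hy ↦
    martingale_re_im_observableProcess_of_cylinder (W := fun t c ↦ W c t) hW hWc hy (hcyl y hy)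
  set 𝓕 := Filtration.natural (fun t c ↦ W c t) hW with h𝓕
  have hWad : StronglyAdapted 𝓕 (fun t c ↦ W c t) := Filtration.stronglyAdapted_natural hW
  -- localisation: `(√(16/3))⁻¹ W` is a continuous local martingale with `⟨·⟩_t = t`
  obtain ⟨hM, hQ⟩ := isLocalMartingale_hasQuadraticVariation_of_fkObservable (W := fun t c ↦ W c t)
    (P := μ) hWad hWc hW0 (y₀ := 1) (fun y hy ↦ (hmart y (by linarith)).1)
    (fun y hy ↦ (hmart y (by linarith)).2)
  have hcast : ((16 / 3 : ℝ≥0) : ℝ) = 16 / 3 := by norm_num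
  have hM' : IsLocalMartingale (fun t c ↦ (Real.sqrt ((16 / 3 : ℝ≥0) : ℝ))⁻¹ * W c t) 𝓕 μ := by
    rw [hcast]; exact hM
  have hQ' : HasQuadraticVariation (fun t c ↦ (Real.sqrt ((16 / 3 : ℝ≥0) : ℝ))⁻¹ * W c t)
      (fun t _ ↦ (t : ℝ)) 𝓕 μ := by
    rw [hcast]; exact hQ
  -- Lévy ⟹ Brownian coupling ⟹ SLE_{16/3} law
  obtain ⟨νc, hνc⟩ := exists_isSLEDrivingCoupling_of_isLocalMartingale_driving sixteen_thirds_pos φ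
    (fun t ↦ (hW t).measurable) (ae_of_all _ hW0) (ae_of_all _ hWc) hM' hQ' hdrv
  exact isSLELaw_sixteen_thirds_of_isSLEDrivingCoupling hφ hνc

/-! ### (J₀) ∧ (D) ⟹ the driving data and the SLE_{16/3} law, for one limit and one uniformizing map -/

section LimitData

variable {D : DobrushinDomain} {φ : ConformalEquiv upperHalfPlaneSet D.carrier}
  {μ : Measure (CurveClass ℂ)} [IsProbabilityMeasure μ]
  {Ω' : ℕ → Type*} {mΩ' : ∀ k, MeasurableSpace (Ω' k)} {P : ∀ k, Measure (Ω' k)}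
  [∀ k, IsProbabilityMeasure (P k)] {V : ∀ k, ℝ≥0 → Ω' k → ℝ}

/-- **The driving process of one subsequential limit and its cylinder identity, from the
moment-free Kemppainen–Smirnov data (J₀) and the discrete observable martingales (D).** Inputs,
for a chordal uniformizing map `φ` of `(D; a, b)` and a probability measure `μ` on curve classes:
(J₀) `μ`-a.e. curve class is describable by the Loewner evolution through `φ` and starts at `a`,
and the continuous-path processes `V^k` (the capacity driving processes of the discrete
interfaces, on their own probability spaces) converge in distribution in `C([0, ∞), ℝ)` to the
driving function of the limit (Kemppainen–Smirnov 2017, Thm. 1.5 (iv)–(v) and Cor. 1.7; CDHKS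
Thm. 3 with Thm. 4); (D) the discrete observable martingale data of
`Loewner.integral_observableProcess_cylinder_eq_zero_of_discreteMartingales` for every `y > 0`
(DCS Lemma 6.6 and Thm. 3.15 = Smirnov 2010, Thm. 2.2). Output: the process
`W c = drivingFunction φ c` (for curves from `a`, `0` otherwise) with strongly measurable
marginals, continuous paths, `W 0 = 0`, `μ`-a.e. driving the curve through `φ`, and the cylinder
identity of its time-limited FK observables. The tail-free form of
`exists_cylinderIdentityData_of_limitData` (whose `L³` clause is the only consumer of the tails).
[cite: CDHKSCRAS2014, Thm. 3 and §3] [cite: DuminilCopinSmirnov2012Clay, Thm. 6.4, Lemma 6.6 and proof of Prop. 6.7 (p. 29)] -/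
theorem exists_drivingData_of_limitData (hφ : D.IsChordalUniformizing φ)
    (hdesc : ∀ᵐ c ∂μ, IsLoewnerDescribable φ c) (hsrc : ∀ᵐ c ∂μ, c.source = D.pt 0)
    (hVc : ∀ k ω, Continuous (V k · ω))
    (hlaw : TendstoInDistribution (fun k ω ↦ (⟨fun u ↦ V k u ω, hVc k ω⟩ : C(ℝ≥0, ℝ))) atTop
      (fun c ↦ (⟨drivingFunction φ c, continuous_drivingFunction φ c⟩ : C(ℝ≥0, ℝ))) P μ)
    (hD : ∀ y : ℝ, 0 < y → ∀ s t : ℝ≥0, s < t → t < cdhksTime y →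
      ∃ (C' : ℝ) (ε Δ η : ℕ → ℝ≥0), Tendsto ε atTop (𝓝 0) ∧ Tendsto Δ atTop (𝓝 0) ∧
        Tendsto η atTop (𝓝 0) ∧
        ∀ k, ∃ (𝒢 : Filtration ℕ (mΩ' k)) (F : ℕ → Ω' k → ℂ) (σ τ : Ω' k → WithTop ℕ)
          (hσ : IsStoppingTime 𝒢 σ) (M : ℕ) (bad : Set (Ω' k)),
          IsStoppingTime 𝒢 τ ∧ Martingale F 𝒢 (P k) ∧ σ ≤ τ ∧ (∀ ω, τ ω ≤ M) ∧
          (∀ u, u ≤ s → Measurable[hσ.measurableSpace] (V k u)) ∧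
          (∀ᵐ ω ∂P k, ‖stoppedValue F σ ω‖ ≤ C') ∧ (∀ᵐ ω ∂P k, ‖stoppedValue F τ ω‖ ≤ C') ∧
          MeasurableSet bad ∧ P k bad ≤ η k ∧
          ∀ᵐ ω ∂P k, ω ∉ bad →
            (∃ u ∈ Icc s (s + Δ k), ‖stoppedValue F σ ω - observableProcess (V k) y u ω‖ ≤ ε k) ∧
            (∃ u ∈ Icc t (t + Δ k), ‖stoppedValue F τ ω - observableProcess (V k) y u ω‖ ≤ ε k)) :
    ∃ W : CurveClass ℂ → ℝ≥0 → ℝ,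
      (∀ t, StronglyMeasurable (fun c ↦ W c t)) ∧ (∀ c, Continuous (W c)) ∧ (∀ c, W c 0 = 0) ∧
      (∀ᵐ c ∂μ, Loewner.IsDrivenBy φ.boundaryExtension (D.pt 1) (W c) c) ∧
      ∀ y : ℝ, 0 < y → ∀ s t : ℝ≥0, s ≤ t → ∀ (n : ℕ) (S : Fin n → ℝ≥0), (∀ k, S k ≤ s) →
        ∀ ψ : (Fin n → ℝ) → ℝ, Continuous ψ → (∀ v, |ψ v| ≤ 1) →
          ∫ c, (observableProcess (fun t c ↦ W c t) y t c -
              observableProcess (fun t c ↦ W c t) y s c) * (ψ (fun k ↦ W c (S k)) : ℂ) ∂μ = 0 := by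
  classical
  -- the driving function, zeroed on the (null) set of curves not starting at `a`
  set W : CurveClass ℂ → ℝ≥0 → ℝ :=
    fun c t ↦ if c.source = D.pt 0 then drivingFunction φ c t else 0 with hWdef
  have hWeq : ∀ {c : CurveClass ℂ}, c.source = D.pt 0 → W c = drivingFunction φ c := by
    intro c hc
    funext t
    simp [hWdef, hc]
  have hWae : ∀ᵐ c ∂μ, W c = drivingFunction φ c := by
    filter_upwards [hsrc] with c hc
    exact hWeq hc
  have hWm : ∀ t, StronglyMeasurable (fun c ↦ W c t) := fun t ↦
    (Measurable.ite (CurveClass.isClosed_setOf_source_eq (D.pt 0)).measurableSet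
      (measurable_drivingFunction_apply hφ t) measurable_const).stronglyMeasurable
  have hWc : ∀ c, Continuous (W c) := by
    intro c
    by_cases hc : c.source = D.pt 0
    · rw [hWeq hc]
      exact continuous_drivingFunction φ c
    · have : W c = 0 := by
        funext t
        simp [hWdef, hc]
      rw [this]
      exact continuous_const
  have hW0 : ∀ c, W c 0 = 0 := by
    intro c
    by_cases hc : c.source = D.pt 0
    · rw [hWeq hc]
      exact drivingFunction_apply_zero hφ hc
    · simp [hWdef, hc]
  -- convergence in distribution to the paths of `W`
  have hlaw' : TendstoInDistribution (fun k ω ↦ (⟨fun u ↦ V k u ω, hVc k ω⟩ : C(ℝ≥0, ℝ))) atTop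
      (fun c ↦ (⟨fun u ↦ W c u, hWc c⟩ : C(ℝ≥0, ℝ))) P μ := by
    refine hlaw.congr (fun k ↦ EventuallyEq.rfl) ?_
    filter_upwards [hWae] with c hc
    ext u
    simp [hc]
  refine ⟨W, hWm, hWc, hW0, ?_, fun y hy ↦ ?_⟩
  · -- a.e. the curve is driven by `W c`
    filter_upwards [hdesc, hsrc] with c hd hs
    rw [hWeq hs]
    exact (isLoewnerDescribed_drivingFunction hd).2
  · -- the cylinder identity, by the passage theorem
    exact integral_observableProcess_cylinder_eq_zero_of_discreteMartingales (W := fun t c ↦ W c t)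
      (fun c ↦ hWc c) hVc hlaw' hy (hD y hy)

/-- **(J₀) ∧ (D) ⟹ the subsequential limit is chordal SLE_{16/3}** (one limit law `μ`, one
chordal uniformizing map `φ`; no tail or moment hypothesis): `exists_drivingData_of_limitData`
followed by `isSLELaw_sixteen_thirds_of_cylinderIdentity'`. This is Duminil-Copin–Smirnov's
Thm. 6.4 + Prop. 6.7 (= the identification step of CDHKS Thm. 2) with exactly its two quoted
inputs as hypotheses, Kemppainen–Smirnov's being used without its Prop. 3.8. The tail-free form
of `isSLELaw_sixteen_thirds_of_limitData`.
[cite: CDHKSCRAS2014, Thm. 2 (proof, §3)] [cite: DuminilCopinSmirnov2012Clay, Thm. 6.4 and Prop. 6.7] -/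
theorem isSLELaw_sixteen_thirds_of_limitData' (hφ : D.IsChordalUniformizing φ)
    (hdesc : ∀ᵐ c ∂μ, IsLoewnerDescribable φ c) (hsrc : ∀ᵐ c ∂μ, c.source = D.pt 0)
    (hVc : ∀ k ω, Continuous (V k · ω))
    (hlaw : TendstoInDistribution (fun k ω ↦ (⟨fun u ↦ V k u ω, hVc k ω⟩ : C(ℝ≥0, ℝ))) atTop
      (fun c ↦ (⟨drivingFunction φ c, continuous_drivingFunction φ c⟩ : C(ℝ≥0, ℝ))) P μ)
    (hD : ∀ y : ℝ, 0 < y → ∀ s t : ℝ≥0, s < t → t < cdhksTime y →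
      ∃ (C' : ℝ) (ε Δ η : ℕ → ℝ≥0), Tendsto ε atTop (𝓝 0) ∧ Tendsto Δ atTop (𝓝 0) ∧
        Tendsto η atTop (𝓝 0) ∧
        ∀ k, ∃ (𝒢 : Filtration ℕ (mΩ' k)) (F : ℕ → Ω' k → ℂ) (σ τ : Ω' k → WithTop ℕ)
          (hσ : IsStoppingTime 𝒢 σ) (M : ℕ) (bad : Set (Ω' k)),
          IsStoppingTime 𝒢 τ ∧ Martingale F 𝒢 (P k) ∧ σ ≤ τ ∧ (∀ ω, τ ω ≤ M) ∧
          (∀ u, u ≤ s → Measurable[hσ.measurableSpace] (V k u)) ∧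
          (∀ᵐ ω ∂P k, ‖stoppedValue F σ ω‖ ≤ C') ∧ (∀ᵐ ω ∂P k, ‖stoppedValue F τ ω‖ ≤ C') ∧
          MeasurableSet bad ∧ P k bad ≤ η k ∧
          ∀ᵐ ω ∂P k, ω ∉ bad →
            (∃ u ∈ Icc s (s + Δ k), ‖stoppedValue F σ ω - observableProcess (V k) y u ω‖ ≤ ε k) ∧
            (∃ u ∈ Icc t (t + Δ k), ‖stoppedValue F τ ω - observableProcess (V k) y u ω‖ ≤ ε k)) :
    IsSLELaw (16 / 3) D μ := by
  obtain ⟨W, hW, hWc, hW0, hdrv, hcyl⟩ := exists_drivingData_of_limitData hφ hdesc hsrc hVc hlaw hD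
  exact isSLELaw_sixteen_thirds_of_cylinderIdentity' hφ hW hWc hW0 hdrv hcyl

end LimitData

/-! ### Global forms: (J₀) ∧ (D) for every limit ⟹ (L), and with `fkIsing_rsw` ⟹ crit-ising.S17 (FK) -/

/-- **(L) from the moment-free limit data (J₀) ∧ (D).** Suppose that for every Dobrushin domain
`(D; a, b)`, every family of admissible discretisations `E` and every subsequential limit law `μ`
of the critical FK-Ising interface laws there is SOME chordal uniformizing map `φ` with: `μ`-a.e.
curve class describable through `φ` (Kemppainen–Smirnov 2017, Thm. 1.5; CDHKS Thm. 3 with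
Thm. 4), discrete driving processes `V^k` on probability spaces `(Ω' k, P k)` converging in
distribution in `C([0, ∞), ℝ)` to `drivingFunction φ` (KS Cor. 1.7), and the discrete observable
martingale data (D) (DCS Lemma 6.6, Smirnov 2010 Thm. 2.2 over the slit domains). Then every
such limit law is the chordal SLE_{16/3} law of `(D; a, b)`: the layer-1 fact (L)
`isSLELaw_of_isSubseqLimitLaw_fkInterfaceCurve` (`FKIsingInterfaceSLE.lean`) holds. The clause
"curves from `a`" of the local theorem is automatic for limits of interface laws
(`ae_source_eq_of_isSubseqLimitLaw_fkInterfaceCurve`); no tail hypothesis (cf.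
`isSLELaw_of_isSubseqLimitLaw_fkInterfaceCurve_of_limitData`).
[cite: CDHKSCRAS2014, Thm. 2 (proof, §3) and Thm. 3] [cite: DuminilCopinSmirnov2012Clay, Thm. 6.4 and Prop. 6.7] -/
theorem isSLELaw_of_isSubseqLimitLaw_fkInterfaceCurve_of_limitData'
    (h : ∀ (D : DobrushinDomain) (E : ℝ → DiscreteDobrushin), IsDiscretisation D E →
      ∀ (μ : Measure (CurveClass ℂ)) [IsProbabilityMeasure μ],
        IsSubseqLimitLaw (Ωδ := fun _ ↦ BondConfig (Site 2))
          (fun δ ↦ fkInterfaceCurve D (E δ)) (fun δ ↦ fkDobrushinMeasure (E δ)) μ →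
        ∃ φ : ConformalEquiv upperHalfPlaneSet D.carrier, D.IsChordalUniformizing φ ∧
          (∀ᵐ c ∂μ, IsLoewnerDescribable φ c) ∧
          ∃ (Ω' : ℕ → Type) (mΩ' : ∀ k, MeasurableSpace (Ω' k)) (P : ∀ k, Measure (Ω' k))
            (_ : ∀ k, IsProbabilityMeasure (P k)) (V : ∀ k, ℝ≥0 → Ω' k → ℝ)
            (hVc : ∀ k ω, Continuous (V k · ω)),
            TendstoInDistribution (fun k ω ↦ (⟨fun u ↦ V k u ω, hVc k ω⟩ : C(ℝ≥0, ℝ))) atTop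
              (fun c ↦ (⟨drivingFunction φ c, continuous_drivingFunction φ c⟩ : C(ℝ≥0, ℝ))) P μ ∧
            (∀ y : ℝ, 0 < y → ∀ s t : ℝ≥0, s < t → t < cdhksTime y →
              ∃ (C' : ℝ) (ε Δ η : ℕ → ℝ≥0), Tendsto ε atTop (𝓝 0) ∧ Tendsto Δ atTop (𝓝 0) ∧
                Tendsto η atTop (𝓝 0) ∧
                ∀ k, ∃ (𝒢 : Filtration ℕ (mΩ' k)) (F : ℕ → Ω' k → ℂ) (σ τ : Ω' k → WithTop ℕ)
                  (hσ : IsStoppingTime 𝒢 σ) (M : ℕ) (bad : Set (Ω' k)),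
                  IsStoppingTime 𝒢 τ ∧ Martingale F 𝒢 (P k) ∧ σ ≤ τ ∧ (∀ ω, τ ω ≤ M) ∧
                  (∀ u, u ≤ s → Measurable[hσ.measurableSpace] (V k u)) ∧
                  (∀ᵐ ω ∂P k, ‖stoppedValue F σ ω‖ ≤ C') ∧
                  (∀ᵐ ω ∂P k, ‖stoppedValue F τ ω‖ ≤ C') ∧
                  MeasurableSet bad ∧ P k bad ≤ η k ∧
                  ∀ᵐ ω ∂P k, ω ∉ bad →
                    (∃ u ∈ Icc s (s + Δ k),
                      ‖stoppedValue F σ ω - observableProcess (V k) y u ω‖ ≤ ε k) ∧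
                    (∃ u ∈ Icc t (t + Δ k),
                      ‖stoppedValue F τ ω - observableProcess (V k) y u ω‖ ≤ ε k))) :
    isSLELaw_of_isSubseqLimitLaw_fkInterfaceCurve := by
  intro D E hE μ hμ hlim
  haveI := hμ
  obtain ⟨φ, hφ, hdesc, Ω', mΩ', P, hP, V, hVc, hlaw, hD⟩ := h D E hE μ hlim
  exact isSLELaw_sixteen_thirds_of_limitData' hφ hdesc
    (ae_source_eq_of_isSubseqLimitLaw_fkInterfaceCurve hE hlim) hVc hlaw hD

/-- **crit-ising.S17 (FK) = CDHKS Theorem 2 from the RSW crossing bound and the moment-free limit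
data (J₀) ∧ (D).** The RSW bound `fkIsing_rsw` for the critical FK-Ising model
(Duminil-Copin–Hongler–Nolin 2011, Thm. 1 = DCS Thm. 3.16) gives the traversal bound (C1)
(`fkInterface_traversalBound_of_fkIsing_rsw`: DCS Lemma 6.3 and §6.1), hence tightness of the
interface laws; the limit data give (L) (`isSLELaw_of_isSubseqLimitLaw_fkInterfaceCurve_of_limitData'`);
uniqueness in law of chordal SLE (`IsSLECurve.map_eq_holds`) assembles CDHKS Theorem 2
(`convergesInLawToSLE_sixteen_thirds_fkInterface_of_traversalBound`). So the named fact
`convergesInLawToSLE_sixteen_thirds_fkInterface` follows from exactly: the RSW theorem,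
Kemppainen–Smirnov's Thm. 1.5 / Cor. 1.7 for the FK-Ising interfaces (describability of the
limit, convergence of the driving processes — no Prop. 3.8), and Smirnov's observable martingales
over the slit domains. [cite: CDHKSCRAS2014, Thm. 2 (proof: Thm. 3, Thm. 4, §3)] -/
theorem convergesInLawToSLE_sixteen_thirds_fkInterface_of_fkIsing_rsw_of_limitData'
    (hrsw : fkIsing_rsw)
    (h : ∀ (D : DobrushinDomain) (E : ℝ → DiscreteDobrushin), IsDiscretisation D E →
      ∀ (μ : Measure (CurveClass ℂ)) [IsProbabilityMeasure μ],
        IsSubseqLimitLaw (Ωδ := fun _ ↦ BondConfig (Site 2))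
          (fun δ ↦ fkInterfaceCurve D (E δ)) (fun δ ↦ fkDobrushinMeasure (E δ)) μ →
        ∃ φ : ConformalEquiv upperHalfPlaneSet D.carrier, D.IsChordalUniformizing φ ∧
          (∀ᵐ c ∂μ, IsLoewnerDescribable φ c) ∧
          ∃ (Ω' : ℕ → Type) (mΩ' : ∀ k, MeasurableSpace (Ω' k)) (P : ∀ k, Measure (Ω' k))
            (_ : ∀ k, IsProbabilityMeasure (P k)) (V : ∀ k, ℝ≥0 → Ω' k → ℝ)
            (hVc : ∀ k ω, Continuous (V k · ω)),
            TendstoInDistribution (fun k ω ↦ (⟨fun u ↦ V k u ω, hVc k ω⟩ : C(ℝ≥0, ℝ))) atTop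
              (fun c ↦ (⟨drivingFunction φ c, continuous_drivingFunction φ c⟩ : C(ℝ≥0, ℝ))) P μ ∧
            (∀ y : ℝ, 0 < y → ∀ s t : ℝ≥0, s < t → t < cdhksTime y →
              ∃ (C' : ℝ) (ε Δ η : ℕ → ℝ≥0), Tendsto ε atTop (𝓝 0) ∧ Tendsto Δ atTop (𝓝 0) ∧
                Tendsto η atTop (𝓝 0) ∧
                ∀ k, ∃ (𝒢 : Filtration ℕ (mΩ' k)) (F : ℕ → Ω' k → ℂ) (σ τ : Ω' k → WithTop ℕ)
                  (hσ : IsStoppingTime 𝒢 σ) (M : ℕ) (bad : Set (Ω' k)),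
                  IsStoppingTime 𝒢 τ ∧ Martingale F 𝒢 (P k) ∧ σ ≤ τ ∧ (∀ ω, τ ω ≤ M) ∧
                  (∀ u, u ≤ s → Measurable[hσ.measurableSpace] (V k u)) ∧
                  (∀ᵐ ω ∂P k, ‖stoppedValue F σ ω‖ ≤ C') ∧
                  (∀ᵐ ω ∂P k, ‖stoppedValue F τ ω‖ ≤ C') ∧
                  MeasurableSet bad ∧ P k bad ≤ η k ∧
                  ∀ᵐ ω ∂P k, ω ∉ bad →
                    (∃ u ∈ Icc s (s + Δ k),
                      ‖stoppedValue F σ ω - observableProcess (V k) y u ω‖ ≤ ε k) ∧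
                    (∃ u ∈ Icc t (t + Δ k),
                      ‖stoppedValue F τ ω - observableProcess (V k) y u ω‖ ≤ ε k))) :
    convergesInLawToSLE_sixteen_thirds_fkInterface :=
  convergesInLawToSLE_sixteen_thirds_fkInterface_of_traversalBound IsSLECurve.map_eq_holds
    (fkInterface_traversalBound_of_fkIsing_rsw hrsw)
    (isSLELaw_of_isSubseqLimitLaw_fkInterfaceCurve_of_limitData' h)

end Literature.Probability.LatticeModels
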